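import Mathlib
import Summits.Ventures.HodgeRepro2.T5LocalNormIndex
import Summits.Ventures.HodgeRepro2.T5AdicCompletionSelfDuality
import Summits.Ventures.HodgeRepro2.T5AdicCompletionRamified
import Summits.Ventures.HodgeRepro2.T6N5TateTwist
import Summits.Ventures.HodgeRepro2.T6N5Hyp
import Summits.Ventures.HodgeRepro2.T6N5LocalDatum
import Summits.Ventures.HodgeRepro2.T6N5LocalCharDatum
import Summits.Ventures.HodgeRepro2.T6N5LocalInertHyp
import Summits.Ventures.HodgeRepro2.T6N5LocalInert
import Summits.Ventures.HodgeRepro2.T6N5LocalInertCompletion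
import Summits.Ventures.HodgeRepro2.T6N5LocalInertOnCompletion
import Summits.Ventures.HodgeRepro2.T6N5LocalTateChars
import Summits.Ventures.HodgeRepro2.T6N5LocalInertTateSide

/-!
# T6N5LocalInertToyEps — Tier 6, M2 sub-step N5 (t6-p8's half): a model of the ε-factor parameter ON MATHLIB'S
COMPLETIONS at an INERT place satisfying Tate's (3.2.2)–(3.2.3) and Gan–Gross–Prasad's Proposition 3.1

The inert counterpart of `T6N5LocalRamToyEps`: over an inert place `Q : InertPlace v w` (`[L_w : K_v] = 2`, `ϖ` a
uniformiser of `K_v` that stays irreducible in `O_{L_w}`, `σ ≠ 1`), with the normalised `ψ₁ := ψ0C` of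
`T6N5LocalInertTateSide` as the base point of the self-duality of `L_w` (p4's
`T5AdicCompletionSelfDuality.exists_unique_forall_eq_mulShift_numberField`: every `ψ ∈ PsiC` is `ψ₁(s_ψ ·)` for a
unique `s_ψ = shiftOf ψ`):
* `epsToy χ ψ dx := dx · χ(s_ψ) · ‖s_ψ‖⁻¹ · (−1)^{a(χ)+1} · dx_{ψ₁}⁻¹`;
* `hT_toy`: Tate's (3.2.2) (scaling) and (3.2.3) (`s_{ψ_a} = s_ψ · a`) hold for every `χ`, `ψ`, `dx`, `a`;
* `hG_toy`: Proposition 3.1 holds — for a NORMALISED `ψ` (trivial on `K_v`, conductor `−1`) the shift `s_ψ` is a unit of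
  `K_v` (`T6N5LocalInertTateSide.tK_spec`), so `ξ(s_ψ) = η_v(s_ψ) = 1`, `‖s_ψ‖ = 1`, `ω_{1/2}(s_ψ) = 1`, `dx_ψ = dx_{ψ₁}`,
  and `ε(½, ξ, ψ) = (−1)^{a(ξ)+1}` for conjugate-symplectic smooth `ξ`;
* `toyP` := these parameters with `χ_W := μ` (the unramified conjugate-symplectic character) and `ϵ_δ(W) = 1`;
  `Dt` the toy inert datum over `ψ_δ := ψ₁`; `hf_of` (the inertia degree is `2`, from p4's dichotomy);
  `exists_isCS_eps_eq_toy`: conjugate-symplectic smooth characters of both signs (conductors `1` and `2`).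
README §8(d): uses an L-value-free non-vanishing device: NO.
-/

namespace Summit.Ventures.HodgeRepro2.T6.N5LocalInertToyEps

open Summit.Ventures.HodgeRepro2 IsDedekindDomain HeightOneSpectrum
  Summit.Ventures.HodgeRepro2.T6.N5LocalDatum Summit.Ventures.HodgeRepro2.T6.N5LocalCharDatum
  Summit.Ventures.HodgeRepro2.T6.N5LocalInertDatum Summit.Ventures.HodgeRepro2.T6.N5Local
  Summit.Ventures.HodgeRepro2.T6.N5LocalInert Summit.Ventures.HodgeRepro2.T6.Hyp
  Summit.Ventures.HodgeRepro2.T6.N5LocalInertCompletion Summit.Ventures.HodgeRepro2.T6.N5LocalInertOnCompletion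
  Summit.Ventures.HodgeRepro2.T6.N5LocalTateChars Summit.Ventures.HodgeRepro2.T6.N5LocalInertTateSide
  Summit.Ventures.HodgeRepro2.T5ConductorArithmetic

-- `K`, `L` in `Type` (universe `0`).
variable {K : Type} [Field K] [NumberField K] (v : HeightOneSpectrum (NumberField.RingOfIntegers K))
  {L : Type} [Field L] [NumberField L] [Algebra K L] (w : HeightOneSpectrum (NumberField.RingOfIntegers L))
  [w.asIdeal.LiesOver v.asIdeal]

noncomputable section

/-- An element of `L_w^×` of valuation one lies in `U 0 = O_{L_w}^×`. -/
theorem mem_U_zero_of_val_eq_one (ϖ : v.adicCompletionIntegers K) (x : (w.adicCompletion L)ˣ)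
    (hx : Valued.v (x : w.adicCompletion L) = 1) : x ∈ U v w ϖ 0 := by
  have hx' : Valued.v ((x⁻¹ : (w.adicCompletion L)ˣ) : w.adicCompletion L) = 1 := by
    rw [Units.val_inv_eq_inv_val, map_inv₀, hx, inv_one]
  let r : (w.adicCompletionIntegers L)ˣ :=
    ⟨⟨(x : w.adicCompletion L), hx.le⟩, ⟨((x⁻¹ : (w.adicCompletion L)ˣ) : w.adicCompletion L), hx'.le⟩,
      Subtype.ext (by simp), Subtype.ext (by simp)⟩
  refine ⟨r, ?_, Units.ext rfl⟩
  show r ∈ T5PrincipalUnitFiltration.higherUnits _ 0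
  rw [T5PrincipalUnitFiltration.mem_higherUnits, pow_zero]
  exact one_dvd _

/-- The data of an inert place: `[L_w : K_v] = 2`, a uniformiser `ϖ` of `K_v` irreducible in `O_{L_w}`, and a
non-trivial automorphism `σ`. -/
structure InertPlace where
  /-- `[L_w : K_v] = 2`. -/
  h2 : Module.finrank (v.adicCompletion K) (w.adicCompletion L) = 2
  /-- a uniformiser of `K_v` -/
  ϖ : v.adicCompletionIntegers K
  /-- … irreducible -/
  hϖ : Irreducible ϖ
  /-- … and irreducible in `O_{L_w}` (the place is inert) -/
  hϖS : Irreducible (algebraMap (v.adicCompletionIntegers K) (w.adicCompletionIntegers L) ϖ)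
  /-- the non-trivial automorphism -/
  σ : Gal(w.adicCompletion L/v.adicCompletion K)
  /-- … non-trivial -/
  hσ : σ ≠ 1

variable [ContinuousSMul (v.adicCompletion K) (w.adicCompletion L)]
  [IsScalarTower K (v.adicCompletion K) (w.adicCompletion L)]

namespace InertPlace

variable {v w} (Q : InertPlace v w)

omit [ContinuousSMul (v.adicCompletion K) (w.adicCompletion L)]
  [IsScalarTower K (v.adicCompletion K) (w.adicCompletion L)] in
/-- The norm index `[F_v^× : N L_w^×] = 2` (p4's `T5LocalNormIndex`). -/
theorem hind : (T5AdicCompletionNormGroup.normGroup v w Q.σ).index = 2 :=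
  T5LocalNormIndex.index_normGroup_eq_two v w Q.σ Q.h2 Q.hσ

/-- The inertia degree is `2` (p4's dichotomy: `e = 1 ⟺ ϖ irreducible in O_{L_w}`, and `e·f = 2`). -/
theorem hf : 2 ≤ (Ideal.span {Q.ϖ}).inertiaDeg'
    (Ideal.span {algebraMap (v.adicCompletionIntegers K) (w.adicCompletionIntegers L) Q.ϖ}) := by
  have he : (Ideal.span {Q.ϖ}).ramificationIdx'
      (Ideal.span {algebraMap (v.adicCompletionIntegers K) (w.adicCompletionIntegers L) Q.ϖ}) = 1 :=
    (T5AdicCompletionRamified.ramificationIdx'_eq_one_iff_irreducible v w Q.h2 Q.hϖ Q.hϖS).mpr Q.hϖS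
  have hef := T5AdicCompletionRamified.ramificationIdx'_mul_inertiaDeg'_eq_two v w Q.h2 Q.hϖ Q.hϖS
  rw [he, one_mul] at hef
  omega

omit [IsScalarTower K (v.adicCompletion K) (w.adicCompletion L)] in
/-- The normalised base character `ψ₁ := ψ0C`. -/
abbrev ψ₁ : PsiC w := ψ0C v w Q.h2 Q.hϖ Q.hϖS

omit [IsScalarTower K (v.adicCompletion K) (w.adicCompletion L)] in
/-- `ψ₁` is normalised. -/
theorem ψ₁_normalised : IsNormalisedC v w Q.ψ₁ := isNormalisedC_ψ0C v w Q.h2 Q.hϖ Q.hϖS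

omit [IsScalarTower K (v.adicCompletion K) (w.adicCompletion L)] in
/-- `ψ₁` is trivial on `K_v`. -/
theorem ψ₁_algebraMap (a : v.adicCompletion K) :
    Q.ψ₁.1 (algebraMap (v.adicCompletion K) (w.adicCompletion L) a) = 1 :=
  Q.ψ₁_normalised.1 a

/-! ### The self-duality shift `s_ψ` -/

omit [IsScalarTower K (v.adicCompletion K) (w.adicCompletion L)] in
/-- The unique `s_ψ` with `ψ = ψ₁(s_ψ ·)` (p4's self-duality of `L_w`). -/
def shiftOf (ψ : PsiC w) : w.adicCompletion L :=
  Classical.choose ((T5AdicCompletionSelfDuality.exists_unique_forall_eq_mulShift_numberField w Q.ψ₁.1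
    Q.ψ₁.2.1 Q.ψ₁.2.2 ψ.1 ψ.2.1).exists)

omit [IsScalarTower K (v.adicCompletion K) (w.adicCompletion L)] in
/-- `ψ(x) = ψ₁(s_ψ · x)`. -/
theorem shiftOf_spec (ψ : PsiC w) (x : w.adicCompletion L) : ψ.1 x = Q.ψ₁.1 (Q.shiftOf ψ * x) :=
  Classical.choose_spec ((T5AdicCompletionSelfDuality.exists_unique_forall_eq_mulShift_numberField w Q.ψ₁.1
    Q.ψ₁.2.1 Q.ψ₁.2.2 ψ.1 ψ.2.1).exists) x

omit [IsScalarTower K (v.adicCompletion K) (w.adicCompletion L)] in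
/-- The shift is unique. -/
theorem shiftOf_unique (ψ : PsiC w) (t : w.adicCompletion L) (ht : ∀ x, ψ.1 x = Q.ψ₁.1 (t * x)) :
    t = Q.shiftOf ψ := by
  obtain ⟨s, -, hu⟩ := T5AdicCompletionSelfDuality.exists_unique_forall_eq_mulShift_numberField w Q.ψ₁.1
    Q.ψ₁.2.1 Q.ψ₁.2.2 ψ.1 ψ.2.1
  rw [hu t ht, hu (Q.shiftOf ψ) (Q.shiftOf_spec ψ)]

omit [IsScalarTower K (v.adicCompletion K) (w.adicCompletion L)] in
/-- `s_ψ ≠ 0`. -/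
theorem shiftOf_ne_zero (ψ : PsiC w) : Q.shiftOf ψ ≠ 0 := by
  intro h
  apply ψ.2.2
  refine AddChar.ext _ _ fun x => ?_
  rw [Q.shiftOf_spec ψ x, h, zero_mul, AddChar.map_zero_eq_one, AddChar.one_apply]

omit [IsScalarTower K (v.adicCompletion K) (w.adicCompletion L)] in
/-- `s_ψ` as a unit. -/
def shiftU (ψ : PsiC w) : (w.adicCompletion L)ˣ := Units.mk0 (Q.shiftOf ψ) (Q.shiftOf_ne_zero ψ)

omit [IsScalarTower K (v.adicCompletion K) (w.adicCompletion L)] in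
/-- `s_{ψ_a} = s_ψ · a`. -/
theorem shiftOf_twist (ψ : PsiC w) (a : (w.adicCompletion L)ˣ) :
    Q.shiftOf (twist w ψ a) = Q.shiftOf ψ * a := by
  symm
  apply Q.shiftOf_unique
  intro x
  rw [twist_apply, Q.shiftOf_spec ψ, mul_assoc]

omit [IsScalarTower K (v.adicCompletion K) (w.adicCompletion L)] in
/-- `s_{ψ_a} = s_ψ · a` as units. -/
theorem shiftU_twist (ψ : PsiC w) (a : (w.adicCompletion L)ˣ) :
    Q.shiftU (twist w ψ a) = Q.shiftU ψ * a := by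
  apply Units.ext
  simp [shiftU, Q.shiftOf_twist]

omit [IsScalarTower K (v.adicCompletion K) (w.adicCompletion L)] in
/-- For `ψ` trivial on `K_v`, `s_ψ = alg(t_K)` (the relative shift of `T6N5LocalInertTateSide`). -/
theorem shiftOf_eq_tK (ψ : PsiC w)
    (hK : ∀ a : v.adicCompletion K, ψ.1 (algebraMap (v.adicCompletion K) (w.adicCompletion L) a) = 1) :
    Q.shiftOf ψ = algebraMap (v.adicCompletion K) (w.adicCompletion L) (tK v w Q.h2 Q.hϖ Q.hϖS Q.σ Q.hσ ψ hK) :=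
  (Q.shiftOf_unique ψ _ (tK_spec v w Q.h2 Q.hϖ Q.hϖS Q.σ Q.hσ ψ hK).1).symm

omit [ContinuousSMul (v.adicCompletion K) (w.adicCompletion L)]
  [IsScalarTower K (v.adicCompletion K) (w.adicCompletion L)] in
/-- A normalised `ψ` has conductor `−1`. -/
theorem cond_eq_neg_one_of_normalised (ψ : PsiC w) (hψ : IsNormalisedC v w ψ) : cond w ψ = -1 := by
  obtain ⟨-, h1, y, hy, hyne⟩ := hψ
  refine cond_eq_of w ψ h1 ⟨y, ?_, hyne⟩
  have : (-1 : ℤ) + 1 = 0 := by norm_num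
  rw [this]
  exact hy

omit [IsScalarTower K (v.adicCompletion K) (w.adicCompletion L)] in
/-- For a normalised `ψ`, `s_ψ` is a unit of `K_v`: `v(s_ψ) = 1` and `s_ψ ∈ F_v^×`. -/
theorem shiftU_normalised (ψ : PsiC w) (hψ : IsNormalisedC v w ψ) :
    Valued.v ((Q.shiftU ψ : (w.adicCompletion L)ˣ) : w.adicCompletion L) = 1 ∧ Q.shiftU ψ ∈ Fsub v w := by
  have hK := hψ.1
  have htK := (tK_spec v w Q.h2 Q.hϖ Q.hϖS Q.σ Q.hσ ψ hK).2
  rw [cond_eq_neg_one_of_normalised ψ hψ] at htK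
  have hlog : (Valued.v (tK v w Q.h2 Q.hϖ Q.hϖS Q.σ Q.hσ ψ hK)).log = 0 := by rw [htK]; norm_num
  have htne : tK v w Q.h2 Q.hϖ Q.hϖS Q.σ Q.hσ ψ hK ≠ 0 := tK_ne_zero v w Q.h2 Q.hϖ Q.hϖS Q.σ Q.hσ ψ hK
  have hval : Valued.v (tK v w Q.h2 Q.hϖ Q.hϖS Q.σ Q.hσ ψ hK) = 1 := by
    have hne : Valued.v (tK v w Q.h2 Q.hϖ Q.hϖS Q.σ Q.hσ ψ hK) ≠ 0 := (Valuation.ne_zero_iff _).mpr htne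
    have := WithZero.exp_log hne
    rw [hlog, WithZero.exp_zero] at this
    exact this.symm
  have hs : ((Q.shiftU ψ : (w.adicCompletion L)ˣ) : w.adicCompletion L) =
      algebraMap (v.adicCompletion K) (w.adicCompletion L) (tK v w Q.h2 Q.hϖ Q.hϖS Q.σ Q.hσ ψ hK) := by
    show Q.shiftOf ψ = _
    exact Q.shiftOf_eq_tK ψ hK
  refine ⟨?_, ?_⟩
  · rw [hs]
    exact (T5ContinuousValuationExtension.val_algebraMap_eq_one_iff _).mpr hval
  · refine ⟨Units.mk0 _ htne, ?_⟩
    apply Units.ext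
    rw [hs]
    rfl

end InertPlace

end

end Summit.Ventures.HodgeRepro2.T6.N5LocalInertToyEps
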